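import Summits.AtomisticToContinuum.FouriersLaw.Theorems.LatticeLandauDampingAbelThermodynamicLimitWitnessRegularisationOfWitnessTightness

/-!
# `LatticeLandauDamping.AbelThermodynamicLimit`, line `series-law-at-every-laplace-frequency`:
# witness tightness (WT) reduced to a uniform pinning-energy bound, and the moment form of (WT)

Support file for item `stmt-AtomisticToContinuum-14013` (crux
`Summit.AtomisticToContinuum.FouriersLaw.Theses.LatticeLandauDamping.AbelThermodynamicLimit`); closes
nothing; proves the registered REDUCTION stub `stub_witnessTightOfUniformEnergyBound` of the registered
stub `stub_witnessTight` (WT, the residual of the witness-regularisation seam after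
`stub_witnessRegularisationOfWitnessTightness`,
`Theorems/LatticeLandauDampingAbelThermodynamicLimitWitnessRegularisationOfWitnessTightness.lean`).

(WT): for `P = pinnedChain ω₂ lam β γ` (all `> 0`) and `T > 0`, the DLR state `μ` of every Abelian
Green–Kubo witness `(μ, D, κ)` at `T` is ONE-SITE TIGHT uniformly in the site,
`∀ ε > 0 ∃ R ∀ x, μ {R < |q_x|} ≤ ε`.

## What is proved here (all proofs complete, no named fact)

* §1 `oneSiteTight_of_lintegral_comp_abs_le` / `exists_lintegral_comp_abs_le_of_oneSiteTight`: for ANY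
  measure on `ChainConfig`, one-site tightness is EQUIVALENT to a uniform coercive-moment bound
  `sup_x ∫ g(|q_x|) dμ < ∞` for some monotone `g : ℝ → ℝ≥0∞` with `g → ∞` (Markov / de la
  Vallée-Poussin); instances: `oneSiteTight_of_lintegral_rpow_abs_le` (LLL 1977 temperedness (18),
  `sup_x ∫ |q_x|^p dμ < ∞`, any `p > 0`) and `oneSiteTight_of_lintegral_pinning_le` (pinned chain,
  `ω₂ > 0`, `lam ≥ 0`: a uniform PINNING-ENERGY bound `sup_x ∫ U(q_x) dμ < ∞`; `U(q) ≥ ω₂ q²/2`,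
  Chebyshev via `oneSiteTight_of_lintegral_sq_le`).
* §2 `stub_witnessTightOfUniformEnergyBound` (registered on stmt-14013): (WT) with the extra hypothesis
  "the witness state has bounded pinning-energy density, `∃ M ∀ x, ∫⁻ U(q_x) dμ ≤ M`". So (WT) is
  EXACTLY the statement "witness states have a uniform coercive position moment" (§1), of which the
  energy form is the one every known mechanism delivers (BM superstability (2.3) ⇒ Gaussian tails,
  sibling file §1; shift invariance ⇒ tight, seam file §4; entropy-density bounds ⇒ energy density).

## Status of (WT) after this wave (diagnosis, 2026-08-16; nothing below is used in a proof)

(WT) is NOT decidable from the tree, and the obstruction is now quantified.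

* **DLR alone does not give tightness for `lam, β > 0` either** (route (B) of the brief is closed
  negatively, at paper level). The positions of a DLR state form the 1-D nearest-neighbour chain with
  one-site conditional density `∝ exp(-[U(q) + V(b-q) + V(q-a)]/T)`; its mode is a CONTRACTION of the
  neighbours (`q ≈ θ·a` for `a = b → ∞`, `θ/(1-θ) = (2β/lam)^{1/3}`), so non-tight states must be
  centred on geometrically growing static equilibria `U'(m_x) = V'(m_{x+1}-m_x) - V'(m_x-m_{x-1})`,
  `m_x ~ c ρ^{|x|}` with `lam = β (ρ-1)³ (1-ρ⁻³)` (`ρ = 2.0425` at `lam = β = 1`). These exist and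
  two- and three-site consistency does NOT kill them: the finite-volume Gibbs measures on `[-n, n]` with
  boundary condition `q_{±(n+1)} = 3ρ^{n+1}` (`ω₂ = lam = β = T = 1`), computed by exact transfer
  integration (script `stretched_pure.py` of this worker), have bulk marginals INDEPENDENT of `n` to
  4 digits from `n = 2` to `n = 10` (`q_0`: mean 3.460, sd 0.113; `q_1`: 6.161, 0.065; `q_2`: 12.512,
  0.032; mode ratios `m_{x+1}/m_x = 2.0425 = ρ` and `m_x ≈ 3.0 ρ^{|x|}` for `|x| ≥ 2`; `sd(q_x)`
  shrinking by the factor `ρ` per site): at paper level the thermodynamic limit along these boundary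
  conditions is a DLR state (Feller specification, locally tight family) with `E q_x ≈ 3.0 ρ^{|x|}` —
  a "stretched" state, the anharmonic analogue of the Gaussian states of the harmonic chain centred at
  `Aλ^x + Bλ^{-x}` (there obtained by translation; here by the same boundary limit, the energy being
  uniformly convex, `Hess H ≥ ω₂`, Brascamp–Lieb), and mixtures over the amplitude `c` would give DLR
  states with `E|q_0| = ∞`: not even a per-site moment bound follows from DLR alone.
* **Hence (WT) must use the dynamics / Abel clauses, and nothing in the tree links them to the spatial
  structure of `μ`.** The only mechanism (sibling file, header): along a stretched profile the
  stiffness `V''(m_{x+1}-m_x) ~ 3β c²(ρ-1)² ρ^{2|x|}` grows geometrically, the acoustic travel time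
  from `±∞` to the origin `Σ_x V''^{-1/2}` is FINITE (`= 0.386` for the profile above), so `±∞` are
  regular boundary points of the linearised wave equation: existence of SOME norm-preserving
  ("reflecting") infinite-volume flow on a full-measure carrier is plausible, uniqueness inside a
  full-measure carrier (the `unique` field) and absolute convergence of `Σ_x |⟨j_0 ; j_x ∘ φ_t⟩|`
  (static prefactor `V'(m_{x+1}-m_x) ~ ρ^{3|x|}` against a momentum response with no light cone) are
  both doubtful — neither a proof nor a Lean-level counterexample of (WT) is within reach. LLL 1977
  Thm 3 (tree, `LanfordLebowitzLieb1977_thm3_chain_holds`) gives a.e. GLOBAL SOLUTIONS for every DLR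
  state, stretched ones included, so existence of orbits is not the obstruction; `PreservesMeasure`
  adds to DLR (which is already infinitesimal invariance) only global-in-time information.
* Residual, as a Lean statement: (WT) itself, equivalently (§1) "every witness state admits a
  uniform coercive position moment"; sufficient named forms: LLL temperedness (18) of witness states
  (`∃ p > 0, ∃ C, ∀ x, ∫⁻ |q_x|^p dμ ≤ C`, `oneSiteTight_of_lintegral_rpow_abs_le`) or the registered
  energy form `∃ M, ∀ x, ∫⁻ U(q_x) dμ ≤ M` (hypothesis of `stub_witnessTightOfUniformEnergyBound`).
  Recommended resolution unchanged (planner level): quantify the crux's witness clause over REGULAR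
  (shift-invariant, BM-superstable) states; then the seam and (WT) disappear.
-/

noncomputable section

namespace Summit.AtomisticToContinuum.FouriersLaw.Theorems.AbelThermodynamicLimit.SeriesLawAtEveryLaplaceFrequency

open MeasureTheory Filter Set
open scoped ENNReal NNReal Topology
open Literature.MathematicalPhysics.KineticTheory.HeatConduction

/-! ## §1 One-site tightness ⇔ a uniform coercive moment bound -/

/-- **Markov form of one-site tightness.** If `g : ℝ → ℝ≥0∞` is monotone with `g(R) → ∞` and
`sup_x ∫ g(|q_x|) dμ ≤ M < ∞`, then `μ` is one-site tight uniformly in the site: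
`μ {R < |q_x|} ≤ μ {g R ≤ g |q_x|} ≤ M / g(R) → 0`. [folklore] -/
theorem oneSiteTight_of_lintegral_comp_abs_le {μ : Measure ChainConfig} {g : ℝ → ℝ≥0∞}
    (hg : Monotone g) (hg' : Tendsto g atTop (𝓝 ∞)) {M : ℝ≥0∞} (hM : M ≠ ∞)
    (h : ∀ x : ℤ, ∫⁻ σ, g |(σ x).1| ∂μ ≤ M) :
    ∀ ε : ℝ, 0 < ε → ∃ R : ℝ, ∀ x : ℤ,
      μ {σ : ChainConfig | R < |(σ x).1|} ≤ ENNReal.ofReal ε := by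
  intro ε hε
  have hε' : ENNReal.ofReal ε ≠ 0 := (ENNReal.ofReal_pos.mpr hε).ne'
  have hmul : Tendsto (fun R => ENNReal.ofReal ε * g R) atTop (𝓝 ∞) := by
    have := ENNReal.Tendsto.const_mul hg' (Or.inr ENNReal.ofReal_ne_top) (a := ENNReal.ofReal ε)
    rwa [ENNReal.mul_top hε'] at this
  obtain ⟨R, hR⟩ := ((ENNReal.tendsto_nhds_top_iff_nnreal.1 hmul) M.toNNReal).exists
  rw [ENNReal.coe_toNNReal hM] at hR
  refine ⟨R, fun x => ?_⟩
  have hmeas : AEMeasurable (fun σ : ChainConfig => g |(σ x).1|) μ :=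
    (hg.measurable.comp (continuous_abs.measurable.comp (measurable_pi_apply x).fst)).aemeasurable
  have hsub : {σ : ChainConfig | R < |(σ x).1|} ⊆ {σ : ChainConfig | g R ≤ g |(σ x).1|} :=
    fun σ hσ => hg (le_of_lt hσ)
  by_contra hcon
  rw [not_le] at hcon
  have h1 : g R * ENNReal.ofReal ε ≤ g R * μ {σ : ChainConfig | g R ≤ g |(σ x).1|} := by
    have := hcon.le.trans (measure_mono hsub)
    gcongr
  have h2 : g R * μ {σ : ChainConfig | g R ≤ g |(σ x).1|} ≤ M :=
    (mul_meas_ge_le_lintegral₀ hmeas (g R)).trans (h x)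
  have : M < M :=
    calc M < ENNReal.ofReal ε * g R := hR
      _ = g R * ENNReal.ofReal ε := mul_comm _ _
      _ ≤ g R * μ {σ : ChainConfig | g R ≤ g |(σ x).1|} := h1
      _ ≤ M := h2
  exact lt_irrefl _ this

/-- **de la Vallée-Poussin converse.** A one-site-tight measure on `ChainConfig` admits a uniform
coercive moment: there is a monotone `g : ℝ → ℝ≥0∞` with `g → ∞` and `∫ g(|q_x|) dμ ≤ 1` for every
site (`g(r) = #{k : R_k < r}` for thresholds with `sup_x μ {R_k < |q_x|} ≤ 2^{-(k+1)}`). With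
`oneSiteTight_of_lintegral_comp_abs_le`: one-site tightness ⇔ a uniform coercive moment bound.
[folklore] -/
theorem exists_lintegral_comp_abs_le_of_oneSiteTight {μ : Measure ChainConfig}
    (h : ∀ ε : ℝ, 0 < ε → ∃ R : ℝ, ∀ x : ℤ,
      μ {σ : ChainConfig | R < |(σ x).1|} ≤ ENNReal.ofReal ε) :
    ∃ g : ℝ → ℝ≥0∞, Monotone g ∧ Tendsto g atTop (𝓝 ∞) ∧
      ∀ x : ℤ, ∫⁻ σ, g |(σ x).1| ∂μ ≤ 1 := by
  have hpos : ∀ k : ℕ, (0 : ℝ) < (1 / 2) ^ (k + 1) := fun k => by positivity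
  choose R hR using fun k : ℕ => h ((1 / 2 : ℝ) ^ (k + 1)) (hpos k)
  -- `g r = ∑_k 1[R_k < r]`
  refine ⟨fun r => ∑' k : ℕ, if R k < r then (1 : ℝ≥0∞) else 0, ?_, ?_, ?_⟩
  · intro r r' hrr'
    refine ENNReal.tsum_le_tsum fun k => ?_
    by_cases hk : R k < r
    · rw [if_pos hk, if_pos (lt_of_lt_of_le hk hrr')]
    · rw [if_neg hk]; exact bot_le
  · refine ENNReal.tendsto_nhds_top_iff_nnreal.2 fun N => ?_
    -- for `r > max_{k ≤ ⌈N⌉} R_k` the first `⌈N⌉ + 1` summands equal `1`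
    obtain ⟨n, hn⟩ := exists_nat_gt (N : ℝ)
    have hne : (Finset.range (n + 1)).Nonempty := ⟨0, by simp⟩
    have hev : ∀ᶠ r : ℝ in atTop, ∀ k ∈ Finset.range (n + 1), R k < r := by
      refine (eventually_gt_atTop ((Finset.range (n + 1)).sup' hne R)).mono ?_
      intro r hr k hk
      exact lt_of_le_of_lt (Finset.le_sup' R hk) hr
    filter_upwards [hev] with r hr
    have hNn : (N : ℝ≥0) < (n : ℝ≥0) := by exact_mod_cast hn
    calc (N : ℝ≥0∞) < (n : ℝ≥0∞) := by exact_mod_cast hNn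
      _ < (n : ℝ≥0∞) + 1 := ENNReal.lt_add_right (ENNReal.natCast_ne_top n) one_ne_zero
      _ = ∑ k ∈ Finset.range (n + 1), (if R k < r then (1 : ℝ≥0∞) else 0) := by
            rw [Finset.sum_congr rfl fun k hk => if_pos (hr k hk)]
            simp
      _ ≤ ∑' k : ℕ, (if R k < r then (1 : ℝ≥0∞) else 0) := ENNReal.sum_le_tsum _
  · intro x
    have hmeas : ∀ k : ℕ, Measurable fun σ : ChainConfig =>
        if R k < |(σ x).1| then (1 : ℝ≥0∞) else 0 := fun k =>
      Measurable.ite (measurableSet_tail (R k) x) measurable_const measurable_const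
    have hind : ∀ k : ℕ, ∫⁻ σ, (if R k < |(σ x).1| then (1 : ℝ≥0∞) else 0) ∂μ =
        μ {σ : ChainConfig | R k < |(σ x).1|} := fun k => by
      have hfun : (fun σ : ChainConfig => if R k < |(σ x).1| then (1 : ℝ≥0∞) else 0) =
          {σ : ChainConfig | R k < |(σ x).1|}.indicator 1 := by
        ext σ
        simp [Set.indicator_apply]
      rw [hfun, lintegral_indicator_one (measurableSet_tail (R k) x)]
    have hgeom : ∑' k : ℕ, ENNReal.ofReal ((1 / 2 : ℝ) ^ (k + 1)) = 1 := by
      have hs : Summable fun k : ℕ => ((1 : ℝ) / 2) ^ (k + 1) := by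
        simp_rw [pow_succ]
        exact summable_geometric_two.mul_right _
      rw [← ENNReal.ofReal_tsum_of_nonneg (fun k => (hpos k).le) hs]
      simp_rw [pow_succ]
      rw [tsum_mul_right, tsum_geometric_two]
      norm_num
    calc ∫⁻ σ, (∑' k : ℕ, if R k < |(σ x).1| then (1 : ℝ≥0∞) else 0) ∂μ
        = ∑' k : ℕ, ∫⁻ σ, (if R k < |(σ x).1| then (1 : ℝ≥0∞) else 0) ∂μ :=
          lintegral_tsum fun k => (hmeas k).aemeasurable
      _ = ∑' k : ℕ, μ {σ : ChainConfig | R k < |(σ x).1|} := tsum_congr hind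
      _ ≤ ∑' k : ℕ, ENNReal.ofReal ((1 / 2 : ℝ) ^ (k + 1)) :=
          ENNReal.tsum_le_tsum fun k => hR k x
      _ = 1 := hgeom

/-- **Lanford–Lebowitz–Lieb-tempered states are one-site tight**: a uniform moment bound
`sup_x ∫ |q_x|^p dμ ≤ C` with ANY exponent `p > 0` (LLL 1977 (18), the temperedness hypothesis of their
Thm 4, there with `p > 1`) gives one-site tightness (`g(r) = (r⁺)^p` in
`oneSiteTight_of_lintegral_comp_abs_le`). [folklore] -/
theorem oneSiteTight_of_lintegral_rpow_abs_le {μ : Measure ChainConfig} {p : ℝ} (hp : 0 < p)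
    {C : ℝ} (h : ∀ x : ℤ, ∫⁻ σ, ENNReal.ofReal (|(σ x).1| ^ p) ∂μ ≤ ENNReal.ofReal C) :
    ∀ ε : ℝ, 0 < ε → ∃ R : ℝ, ∀ x : ℤ,
      μ {σ : ChainConfig | R < |(σ x).1|} ≤ ENNReal.ofReal ε := by
  refine oneSiteTight_of_lintegral_comp_abs_le (g := fun r => ENNReal.ofReal ((max r 0) ^ p))
    ?_ ?_ (M := ENNReal.ofReal C) ENNReal.ofReal_ne_top ?_
  · intro r r' hrr'
    exact ENNReal.ofReal_le_ofReal
      (Real.rpow_le_rpow (le_max_right _ _) (max_le_max hrr' le_rfl) hp.le)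
  · have hmax : Tendsto (fun r : ℝ => max r 0) atTop atTop :=
      tendsto_atTop_mono (fun r => le_max_left r 0) tendsto_id
    exact ENNReal.tendsto_ofReal_atTop.comp ((tendsto_rpow_atTop hp).comp hmax)
  · intro x
    have hfun : (fun σ : ChainConfig => ENNReal.ofReal ((max |(σ x).1| 0) ^ p)) =
        fun σ => ENNReal.ofReal (|(σ x).1| ^ p) := by
      funext σ
      rw [max_eq_left (abs_nonneg (σ x).1)]
    show ∫⁻ σ, ENNReal.ofReal ((max |(σ x).1| 0) ^ p) ∂μ ≤ ENNReal.ofReal C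
    rw [hfun]
    exact h x

/-- **Bounded pinning-energy density ⇒ one-site tight** for the pinned chain (`ω₂ > 0`, `lam ≥ 0`):
`U(q) = ω₂ q²/2 + lam q⁴/4 ≥ ω₂ q²/2`, so `sup_x ∫ U(q_x) dμ ≤ M < ∞` bounds the second moments by
`2M/ω₂` and `oneSiteTight_of_lintegral_sq_le` (Chebyshev) applies. [folklore] -/
theorem oneSiteTight_of_lintegral_pinning_le {ω₂ lam : ℝ} (β γ : ℝ) (hω : 0 < ω₂) (hl : 0 ≤ lam)
    {μ : Measure ChainConfig} {M : ℝ≥0∞} (hM : M ≠ ∞)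
    (h : ∀ x : ℤ, ∫⁻ σ, ENNReal.ofReal ((pinnedChain ω₂ lam β γ).U (σ x).1) ∂μ ≤ M) :
    ∀ ε : ℝ, 0 < ε → ∃ R : ℝ, ∀ x : ℤ,
      μ {σ : ChainConfig | R < |(σ x).1|} ≤ ENNReal.ofReal ε := by
  have hUq : ∀ q : ℝ, q ^ 2 ≤ 2 / ω₂ * (pinnedChain ω₂ lam β γ).U q := fun q => by
    show q ^ 2 ≤ 2 / ω₂ * (ω₂ * q ^ 2 / 2 + lam * q ^ 4 / 4)
    have h4 : 0 ≤ lam * q ^ 4 / 4 := by positivity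
    have : 2 / ω₂ * (ω₂ * q ^ 2 / 2 + lam * q ^ 4 / 4) = q ^ 2 + 2 / ω₂ * (lam * q ^ 4 / 4) := by
      field_simp
    rw [this]
    exact le_add_of_nonneg_right (by positivity)
  have hmeasU : ∀ x : ℤ, Measurable fun σ : ChainConfig =>
      ENNReal.ofReal ((pinnedChain ω₂ lam β γ).U (σ x).1) := fun x =>
    ENNReal.measurable_ofReal.comp
      ((OscillatorChain.measurable_pinnedChain_U ω₂ lam β γ).comp (measurable_pi_apply x).fst)
  refine oneSiteTight_of_lintegral_sq_le (M := ENNReal.ofReal (2 / ω₂) * M)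
    (ENNReal.mul_ne_top ENNReal.ofReal_ne_top hM) fun x => ?_
  calc ∫⁻ σ, ENNReal.ofReal ((σ x).1 ^ 2) ∂μ
      ≤ ∫⁻ σ, ENNReal.ofReal (2 / ω₂) * ENNReal.ofReal ((pinnedChain ω₂ lam β γ).U (σ x).1) ∂μ := by
        refine lintegral_mono fun σ => ?_
        rw [← ENNReal.ofReal_mul (by positivity)]
        exact ENNReal.ofReal_le_ofReal (hUq _)
    _ = ENNReal.ofReal (2 / ω₂) * ∫⁻ σ, ENNReal.ofReal ((pinnedChain ω₂ lam β γ).U (σ x).1) ∂μ :=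
        lintegral_const_mul _ (hmeasU x)
    _ ≤ ENNReal.ofReal (2 / ω₂) * M := by have := h x; gcongr

/-! ## §2 The registered reduction -/

/-- **`stub_witnessTightOfUniformEnergyBound`** (registered on stmt-AtomisticToContinuum-14013; reduction
of `stub_witnessTight`, line SketchIdeator2). For `P = pinnedChain ω₂ lam β γ` (all `> 0`) and
`T > 0`: the state `μ` of an Abelian Green–Kubo witness `(μ, D, κ)` at `T` whose PINNING-ENERGY
DENSITY IS BOUNDED, `∃ M ∀ x, ∫⁻ U(q_x) dμ ≤ M`, is one-site tight uniformly in the site. The five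
witness clauses are not used: the content is `oneSiteTight_of_lintegral_pinning_le`; the residual of
(WT) is exactly the energy (or any coercive-moment, §1) bound for witness states. [folklore] -/
theorem stub_witnessTightOfUniformEnergyBound :
    ∀ ω₂ lam β γ : ℝ, 0 < ω₂ → 0 < lam → 0 < β → 0 < γ →
      ∀ T : ℝ, 0 < T →
        ∀ (μ : MeasureTheory.Measure
                Literature.MathematicalPhysics.KineticTheory.HeatConduction.ChainConfig)
            (D : Literature.MathematicalPhysics.KineticTheory.HeatConduction.InfiniteChainDynamics
              (Literature.MathematicalPhysics.KineticTheory.HeatConduction.pinnedChain ω₂ lam β γ))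
            (κ : ℝ),
            (Literature.MathematicalPhysics.KineticTheory.HeatConduction.pinnedChain
                ω₂ lam β γ).IsChainGibbsMeasure T μ → D.PreservesMeasure μ →
            (∀ t : ℝ, D.HasAbsConvergentCorrelation μ t) → 0 < κ →
            Filter.Tendsto (fun ν : ℝ => (T ^ 2)⁻¹ *
              MeasureTheory.integral (MeasureTheory.volume.restrict (Set.Ioi (0:ℝ)))
                (fun t : ℝ => Real.exp (-(ν * t)) * D.currentCorrelation μ t))
              (nhdsWithin (0:ℝ) (Set.Ioi 0)) (nhds κ) →
            (∃ M : ℝ, ∀ x : ℤ,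
              MeasureTheory.lintegral μ (fun σ => ENNReal.ofReal
                ((Literature.MathematicalPhysics.KineticTheory.HeatConduction.pinnedChain
                    ω₂ lam β γ).U (σ x).1)) ≤ ENNReal.ofReal M) →
            ∀ ε : ℝ, 0 < ε → ∃ R : ℝ, ∀ x : ℤ,
              μ {σ : Literature.MathematicalPhysics.KineticTheory.HeatConduction.ChainConfig |
                  R < |(σ x).1|} ≤ ENNReal.ofReal ε := by
  intro ω₂ lam β γ hω hl _hβ _hγ T _hT μ _D _κ _hG _hP _hAC _hκ _hlim hM
  obtain ⟨M, hM⟩ := hM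
  exact oneSiteTight_of_lintegral_pinning_le β γ hω hl.le ENNReal.ofReal_ne_top hM

end Summit.AtomisticToContinuum.FouriersLaw.Theorems.AbelThermodynamicLimit.SeriesLawAtEveryLaplaceFrequency

end
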